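import Literature.AlgebraicGeometry.HodgeTheory.ChernCharacterLawsAlgebraicity
import HarnessLib

/-!
# Rigidity of lawful Chern characters on complex Betti cohomology (LEMMA U for raw data)

Family `hodge`, layer `Literature/AlgebraicGeometry/HodgeTheory`. HONEST FRAMING: nothing here constructs a Chern
character or bears on any case of the Hodge conjecture. Sequel to `HodgeTheory/ChernCharacterLawsAlgebraicity` (the
cycle law `chᵢ(E) ∈ Nⁱ` for every lawful datum) and the raw-data twin of `HodgeTheory/ChernCharacterBettiUniqueness`
(Grothendieck's uniqueness theorem for the hypothesis STRUCTURE `ChernCharacterBetti` under `IsTwistNormalised`).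

THE STATEMENT (`exists_scale_of_laws`, Grothendieck 1958 Thm. 1, uniqueness). Let `ch`, `ch'` be two data
`ch X E i ∈ H²ⁱ(X(ℂ); ℂ)` (every `𝒪_X`-module `E` on every `ℂ`-scheme `X`) each subject to five of the topological laws
of `ChernCharacterBetti` — invariance under isomorphism, additivity on short exact sequences of vector bundles,
functoriality along `ℂ`-morphisms, vanishing in positive degrees on free modules, and the exponential
`chᵢ(L) = ch₁(L)ⁱ/i!` on modules of rank `≤ 1` — and let `ch` be NON-DEGENERATE (`ch₁(L) ≠ 0` for some module `L` of
rank `≤ 1` on some `ℙᴺ`). Then there is ONE scalar `q ∈ ℂ` with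
`ch' X E i = qⁱ • ch X E i` for every vector bundle `E` on every smooth projective complex variety `X` and every `i ≥ 1`;
and `q ≠ 0` as soon as `ch'` is non-degenerate too (`exists_scale_ne_zero_of_laws`). No normalisation, no rationality
(so `q ∈ ℂ`, not `ℚ`), no reference character and no named fact is used. CONSEQUENCE (`span_ch_eq_of_laws`): two
lawful non-degenerate data have the SAME spans `ℂ · {ch_p(E) : E vector bundle}` in every positive degree on every
smooth projective variety — so the span law `Nᵖ H²ᵖ ⊆ ℂ · {ch_p(E)}` (field `algebraicClasses_le_span_ch` of
`ChernCharacterBetti`; the registered stub `stub_span` of the crux line `grothendieck_axiomatic` for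
`ChernCharacterOnBetti`) holds for ALL lawful non-degenerate data as soon as it holds for ONE.

THE ARGUMENT (all inputs are tree theorems; `t_N(ch) := ch₁(𝒪_{ℙᴺ}(-1))`, `𝒪_{ℙᴺ}(-1) = serreTwist (𝟙 ℙᴺ) 1`):
* §1 `σ^* t_K = t_N` for every `σ : ℙᴺ → ℙᴷ` with `[σ^*𝒪(-1)] = [𝒪(-1)]` (rank-one modules are classified by their class,
  III Ex. 4.5; e.g. the Segre embeddings of `(id, const)`, `(const, id)`: `exists_segre_detClass_eq(')`). On the universal
  difference `M = p₂^*𝒪(-1) ⊗ (p₁^*𝒪(-1))^∨` over `ℙᵃ ×_ℂ ℙᵃ` the LAWS compute `ch₁(M) = p₂^* t_a − p₁^* t_a` (Künneth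
  `H² = p₁^*H² ⊕ p₂^*H²`; the slice `(const, id)` sees `𝒪(-1)`, the diagonal sees `𝒪 ≅ 𝒪^{PUnit}`, where `ch₁ = 0`), hence the
  LINE BUNDLE FORMULA `ch₁(L) = ψ^* t_a − φ^* t_a` whenever `[L]·[φ^*𝒪(-1)] = [ψ^*𝒪(-1)]` (`L ≅ (φ, ψ)^*M`), which by
  `LineBundleClassEqDifferenceOfPullbacks_holds` (Hartshorne II 7.1/7.6) is available for every line bundle on a smooth
  projective `X`, with `a` as LARGE as desired (post-compose with Segre maps, `detClass_serreTwist_comp_left_eq`).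
* §2 Non-degeneracy gives ONE `a₁ ≥ 1` with `t_{a₁}(ch) ≠ 0` (line bundle formula on `ℙᴺ`), hence `t_K(ch) ≠ 0` for every
  `K = a₁M + a₁ + M` (§1 along `ℙ^{a₁} → ℙᴷ`); `H²(ℙᴷ(ℂ); ℂ)` is a line (`finrank_complexBetti_projectiveSpace_two_mul`),
  so `t_K(ch') = q_K t_K(ch)`, and `q_K = q_{a₁} =: q` (pull back along `ℙ^{a₁} → ℙᴷ`). Every line bundle admits a
  presentation with index `K = a₁a + a₁ + a` (move `φ, ψ : X → ℙᵃ` along `ℙᵃ → ℙᴷ`), so `ch'₁(L) = q • ch₁(L)`.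
* §3 Rank `≤ 1` in all degrees by the exponential (`RankLEOneDichotomy_holds`), full flags by additivity, all vector
  bundles by `splittingPrincipleBetti_holds` (`f^*` injective) and functoriality — verbatim §4 of
  `ChernCharacterBettiUniqueness`.

## References

* [Grothendieck1958] A. Grothendieck, La théorie des classes de Chern, Bull. SMF 86 (1958): Thm. 1 (unicité), §2.
* [Fulton1984] W. Fulton, Introduction to Intersection Theory in Algebraic Geometry, CBMS 54 (1984): §4.1.
* [Fulton1998] W. Fulton, Intersection Theory, 2nd ed. (1998): Example 3.2.3, §15.1 (ii)–(iii), Example 15.2.16 (b).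
* [Hartshorne1977] R. Hartshorne, Algebraic Geometry (1977): II Thm. 7.1, II Thm. 7.6, II Ex. 5.8 (b), II Ex. 5.11,
  III Ex. 4.5.
* [VoisinHodgeI2002] C. Voisin, Hodge Theory and Complex Algebraic Geometry I (2002): Thm. 7.14, Lemma 7.28, Thm. 11.38.
* [HatcherAT2002] A. Hatcher, Algebraic Topology (2002): §3.2, Thm. 3.16.
* Tree: `HodgeTheory/ChernCharacterLawsAlgebraicity`, `HodgeTheory/ChernCharacterBettiUniqueness` (§2–§4, §8–§9),
  `HodgeTheory/ProjectiveBundleTautologicalQuotientProof`, `HodgeTheory/HypersurfaceLefschetzProofs`, `Modules/SerreTwistTrivial`.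
-/

noncomputable section

open CategoryTheory CategoryTheory.Limits AlgebraicGeometry MonoidalCategory CartesianMonoidalCategory
open Literature.AlgebraicTopology.SingularHomology
open Literature.AlgebraicGeometry.Morphisms.ProjCech (PP)
open Literature.AlgebraicGeometry.Modules.SerreTwist (serreTwist isFiniteLocallyFree_serreTwist hasRank_serreTwist
  detClass_serreTwist_comp detClass_serreTwist_eq_pow serreTwistZeroIso)
open Literature.AlgebraicGeometry.Motives

namespace Literature.AlgebraicGeometry.HodgeTheory

section HodgeTheory

variable (ch ch' : ∀ (X : SchemeOver ℂ) (E : X.left.Modules) (i : ℕ), complexBetti X (2 * i))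

/-! ### §0 Tools -/

/-- `(c • x)ⁱ = cⁱ • xⁱ` for cup powers of a degree-two class (bilinearity of `∪`). [cite: HatcherAT2002, §3.2] -/
private theorem cupPowTwo_smul_aux {Y : Type} [TopologicalSpace Y] (c : ℂ) (x : singularCohomology ℂ ℂ Y 2) (i : ℕ) :
    cupPowTwo (c • x) i = c ^ i • cupPowTwo x i := by
  induction i with
  | zero => rw [cupPowTwo_zero, cupPowTwo_zero, pow_zero, one_smul]
  | succ i ih =>
    rw [cupPowTwo_succ, cupPowTwo_succ, ih]
    simp only [map_smul, LinearMap.smul_apply, smul_smul, pow_succ, mul_comm]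

/-- `H²(ℙᴷ(ℂ); ℂ)` is a line for `K ≥ 1`: every class is a multiple of a given non-zero one (`H²(ℙⁿ; ℤ) = ℤH`).
[cite: VoisinHodgeI2002, Thm. 7.14 (PDF p. 140)] -/
theorem exists_eq_smul_of_ne_zero_complexBetti_projectiveSpace_two {K : ℕ} (hK : 1 ≤ K)
    {x : complexBetti (projectiveSpace K ℂ) 2} (hx : x ≠ 0) (y : complexBetti (projectiveSpace K ℂ) 2) :
    ∃ c : ℂ, y = c • x := by
  have h1 : Module.finrank ℂ (complexBetti (projectiveSpace K ℂ) (2 * 1)) = 1 :=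
    finrank_complexBetti_projectiveSpace_two_mul K (k := 1) hK
  obtain ⟨c, hc⟩ := (finrank_eq_one_iff_of_nonzero' x hx).1 h1 y
  exact ⟨c, hc.symm⟩

/-! ### §1 The tautological classes `t_N(ch) = ch₁(𝒪_{ℙᴺ}(-1))` and the line bundle formula -/

/-- **`σ^* t_K(ch) = t_N(ch)` whenever `[σ^*𝒪_{ℙᴷ}(-1)] = [𝒪_{ℙᴺ}(-1)]`** (`σ : ℙᴺ → ℙᴷ`): `σ^*𝒪_{ℙᴷ}(-1)` and
`𝒪_{ℙᴺ}(-1)` are rank-one modules with the same class in `Ȟ¹(ℙᴺ, 𝒪^×)`, hence isomorphic (III Ex. 4.5); then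
functoriality and isomorphism invariance of `ch`. [cite: Hartshorne1977, III Ex. 4.5 and II Prop. 5.12 (c)]
[cite: Fulton1998, §15.1 (ii) (PDF p. 272)] -/
theorem map_ch_serreTwist_one_eq_of_detClass_eq
    (h_congr : ∀ {X : SchemeOver ℂ} {E F : X.left.Modules} (_ : E ≅ F) (i : ℕ), ch X E i = ch X F i)
    (h_map : ∀ {X Y : SchemeOver ℂ} (f : Y ⟶ X) (E : X.left.Modules), IsVectorBundle E →
      ∀ i : ℕ, complexBetti.map f (2 * i) (ch X E i) = ch Y ((Scheme.Modules.pullback f.left).obj E) i)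
    {N K : ℕ} (σ : projectiveSpace N ℂ ⟶ projectiveSpace K ℂ)
    (hσ : Modules.detClass (isFiniteLocallyFree_serreTwist (σ.left : _ ⟶ PP ℂ K) 1) =
        Modules.detClass (isFiniteLocallyFree_serreTwist
          (𝟙 (projectiveSpace N ℂ).left : (projectiveSpace N ℂ).left ⟶ PP ℂ N) 1)) :
    complexBetti.map σ 2 (ch (projectiveSpace K ℂ)
        (serreTwist (𝟙 (projectiveSpace K ℂ).left : (projectiveSpace K ℂ).left ⟶ PP ℂ K) 1) 1) =
      ch (projectiveSpace N ℂ)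
        (serreTwist (𝟙 (projectiveSpace N ℂ).left : (projectiveSpace N ℂ).left ⟶ PP ℂ N) 1) 1 := by
  have hK := isFiniteLocallyFree_serreTwist
    (𝟙 (projectiveSpace K ℂ).left : (projectiveSpace K ℂ).left ⟶ PP ℂ K) 1
  obtain ⟨e⟩ := (Modules.nonempty_iso_iff_detClass_eq
      (Modules.hasRank_pullback σ.left (hasRank_serreTwist _ 1)) (hasRank_serreTwist _ 1)
      (hK.pullback σ.left) (isFiniteLocallyFree_serreTwist _ 1)).2 (by
    rw [Modules.detClass_pullback σ.left (hE := hK), ← detClass_serreTwist_comp, ← hσ]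
    exact detClass_serreTwist_congr (Category.comp_id _) 1)
  have h := h_map σ _ hK.isVectorBundle 1
  rw [h_congr e 1] at h
  exact h

/-- **Non-vanishing of `t_N(ch)` moves up along Segre maps**: `t_N(ch) ≠ 0 ⟹ t_{NM+N+M}(ch) ≠ 0` (the Segre embedding of
`(id, const) : ℙᴺ → ℙᴺ ×_ℂ ℙᴹ` pulls `𝒪(-1)` back to `𝒪(-1)`, II Ex. 5.11, and `t_N = σ^* t_K`).
[cite: Hartshorne1977, II Ex. 5.11 (p. 125)] -/
theorem ch_serreTwist_one_ne_zero_segre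
    (h_congr : ∀ {X : SchemeOver ℂ} {E F : X.left.Modules} (_ : E ≅ F) (i : ℕ), ch X E i = ch X F i)
    (h_map : ∀ {X Y : SchemeOver ℂ} (f : Y ⟶ X) (E : X.left.Modules), IsVectorBundle E →
      ∀ i : ℕ, complexBetti.map f (2 * i) (ch X E i) = ch Y ((Scheme.Modules.pullback f.left).obj E) i)
    {N : ℕ} (hN : ch (projectiveSpace N ℂ)
        (serreTwist (𝟙 (projectiveSpace N ℂ).left : (projectiveSpace N ℂ).left ⟶ PP ℂ N) 1) 1 ≠ 0) (M : ℕ) :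
    ch (projectiveSpace (N * M + N + M) ℂ)
        (serreTwist (𝟙 (projectiveSpace (N * M + N + M) ℂ).left :
          (projectiveSpace (N * M + N + M) ℂ).left ⟶ PP ℂ (N * M + N + M)) 1) 1 ≠ 0 := by
  obtain ⟨σ, hσ⟩ := exists_segre_detClass_eq N M
  intro h0
  apply hN
  rw [← map_ch_serreTwist_one_eq_of_detClass_eq ch h_congr h_map σ hσ, h0, map_zero]

/-- **The laws compute `ch₁` of the universal difference**: on `ℙᵃ ×_ℂ ℙᵃ`,
`ch₁(p₂^*𝒪(-1) ⊗ (p₁^*𝒪(-1))^∨) = p₂^* t_a − p₁^* t_a`. By Künneth `ch₁(M) = p₁^*α + p₂^*β`; the slice `(const, id)` (where `M`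
restricts to `𝒪(-1)`) gives `β = t_a`; the diagonal (where `M` restricts to `𝒪(-0) ≅ 𝒪 ≅ 𝒪^{PUnit}`, on which `ch₁ = 0` by the
free-module law) gives `α + β = 0`. [cite: Hartshorne1977, III Ex. 4.5 and II Prop. 6.12]
[cite: HatcherAT2002, §3.2 Thm. 3.16] [cite: Fulton1998, §15.1 (ii) and Example 3.2.3] -/
theorem ch_twistDifference_one_eq
    (h_congr : ∀ {X : SchemeOver ℂ} {E F : X.left.Modules} (_ : E ≅ F) (i : ℕ), ch X E i = ch X F i)
    (h_map : ∀ {X Y : SchemeOver ℂ} (f : Y ⟶ X) (E : X.left.Modules), IsVectorBundle E →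
      ∀ i : ℕ, complexBetti.map f (2 * i) (ch X E i) = ch Y ((Scheme.Modules.pullback f.left).obj E) i)
    (h_free : ∀ (X : SchemeOver ℂ) (I : Type) [Finite I] {i : ℕ}, 0 < i →
      ch X (SheafOfModules.free (R := X.left.ringCatSheaf) I) i = 0)
    (a : ℕ) :
    ch (projectiveSpace a ℂ ⊗ projectiveSpace a ℂ) (twistDifference a) 1 =
      complexBetti.map (snd (projectiveSpace a ℂ) (projectiveSpace a ℂ)) 2
          (ch (projectiveSpace a ℂ)
            (serreTwist (𝟙 (projectiveSpace a ℂ).left : (projectiveSpace a ℂ).left ⟶ PP ℂ a) 1) 1) -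
        complexBetti.map (fst (projectiveSpace a ℂ) (projectiveSpace a ℂ)) 2
          (ch (projectiveSpace a ℂ)
            (serreTwist (𝟙 (projectiveSpace a ℂ).left : (projectiveSpace a ℂ).left ⟶ PP ℂ a) 1) 1) := by
  obtain ⟨P⟩ := (isSmoothProjective_projectiveSpace_holds ℂ a).nonempty_algPoints ℂ
  obtain ⟨α, β, hαβ⟩ := exists_eq_map_fst_add_map_snd_projectiveSpaces a a (ch _ (twistDifference a) 1)
  have hM := (isFiniteLocallyFree_twistDifference a).isVectorBundle
  -- the slice `s = (const, id)`: `s^*M ≅ 𝒪(-1)`, so `β = t_a`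
  set s : projectiveSpace a ℂ ⟶ projectiveSpace a ℂ ⊗ projectiveSpace a ℂ := lift (toSpecOver _ ≫ P) (𝟙 _)
    with hs
  have h1 : ((s ≫ snd _ _).left : (projectiveSpace a ℂ).left ⟶ PP ℂ a) = 𝟙 (projectiveSpace a ℂ).left := by
    rw [hs, lift_snd]; rfl
  have h2 : ((s ≫ fst _ _).left : (projectiveSpace a ℂ).left ⟶ PP ℂ a) = (toSpecOver _ ≫ P).left := by
    rw [hs, lift_fst]
  obtain ⟨es⟩ := nonempty_pullback_twistDifference_iso_serreTwist s
    (𝟙 (projectiveSpace a ℂ).left : (projectiveSpace a ℂ).left ⟶ PP ℂ a) 1 (by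
      rw [detClass_serreTwist_congr h1, detClass_serreTwist_congr h2,
        detClass_serreTwist_toSpecOver_comp, inv_one, mul_one])
  have hβ : β = ch (projectiveSpace a ℂ)
      (serreTwist (𝟙 (projectiveSpace a ℂ).left : (projectiveSpace a ℂ).left ⟶ PP ℂ a) 1) 1 := by
    have h := h_map s _ hM 1
    rw [h_congr es 1, hαβ, map_add, complexBetti_map_map_apply, complexBetti_map_map_apply, lift_fst, lift_snd,
      complexBetti_map_toSpecOver_comp_eq_zero P two_ne_zero, zero_add, complexBetti.map_id] at h
    exact h
  -- the diagonal: `Δ^*M ≅ 𝒪(-0) ≅ 𝒪 ≅ 𝒪^{PUnit}`, so `α + β = 0`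
  set Δ : projectiveSpace a ℂ ⟶ projectiveSpace a ℂ ⊗ projectiveSpace a ℂ := lift (𝟙 _) (𝟙 _) with hΔ
  have h1' : ((Δ ≫ snd _ _).left : (projectiveSpace a ℂ).left ⟶ PP ℂ a) = 𝟙 (projectiveSpace a ℂ).left := by
    rw [hΔ, lift_snd]; rfl
  have h2' : ((Δ ≫ fst _ _).left : (projectiveSpace a ℂ).left ⟶ PP ℂ a) = 𝟙 (projectiveSpace a ℂ).left := by
    rw [hΔ, lift_fst]; rfl
  obtain ⟨eΔ⟩ := nonempty_pullback_twistDifference_iso_serreTwist Δ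
    (𝟙 (projectiveSpace a ℂ).left : (projectiveSpace a ℂ).left ⟶ PP ℂ a) 0 (by
      rw [detClass_serreTwist_congr h1', detClass_serreTwist_congr h2', mul_inv_cancel,
        detClass_serreTwist_eq_pow _ 0, pow_zero])
  have e0 : (Scheme.Modules.pullback Δ.left).obj (twistDifference a) ≅
      SheafOfModules.free (R := (projectiveSpace a ℂ).left.ringCatSheaf) (PUnit : Type) :=
    eΔ ≪≫ serreTwistZeroIso _ ≪≫
      (Limits.coproductUniqueIso (fun _ : (PUnit : Type) ↦
        (SheafOfModules.unit (projectiveSpace a ℂ).left.ringCatSheaf : (projectiveSpace a ℂ).left.Modules))).symm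
  have hαβ0 : α + β = 0 := by
    have h := h_map Δ _ hM 1
    rw [h_congr e0 1, h_free _ PUnit one_pos, hαβ, map_add, complexBetti_map_map_apply,
      complexBetti_map_map_apply, lift_fst, lift_snd, complexBetti.map_id] at h
    exact h
  have hα : α = -β := eq_neg_of_add_eq_zero_left hαβ0
  rw [hαβ, hα, hβ, map_neg, neg_add_eq_sub]

/-- **Line bundle formula**: for `L` of rank one with `[L]·[φ^*𝒪(-1)] = [ψ^*𝒪(-1)]` (`φ, ψ : X → ℙᵃ`; i.e.
`L ≅ φ^*𝒪(1) ⊗ ψ^*𝒪(-1) ≅ (φ, ψ)^*M`, III Ex. 4.5), the laws give `ch₁(L) = ψ^* t_a(ch) − φ^* t_a(ch)`.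
[cite: Hartshorne1977, II Thm. 7.1 (p. 150) and III Ex. 4.5] [cite: Fulton1998, §15.1 (ii) (PDF p. 272)] -/
theorem ch_one_eq_of_detClass_eq
    (h_congr : ∀ {X : SchemeOver ℂ} {E F : X.left.Modules} (_ : E ≅ F) (i : ℕ), ch X E i = ch X F i)
    (h_map : ∀ {X Y : SchemeOver ℂ} (f : Y ⟶ X) (E : X.left.Modules), IsVectorBundle E →
      ∀ i : ℕ, complexBetti.map f (2 * i) (ch X E i) = ch Y ((Scheme.Modules.pullback f.left).obj E) i)
    (h_free : ∀ (X : SchemeOver ℂ) (I : Type) [Finite I] {i : ℕ}, 0 < i →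
      ch X (SheafOfModules.free (R := X.left.ringCatSheaf) I) i = 0)
    {X : SchemeOver ℂ} {L : X.left.Modules} (hL : HasRank L 1) {a : ℕ} (φ ψ : X ⟶ projectiveSpace a ℂ)
    (hcl : Modules.detClass (Modules.HasRank.isFiniteLocallyFree' hL) *
        Modules.detClass (isFiniteLocallyFree_serreTwist (φ.left : X.left ⟶ PP ℂ a) 1) =
      Modules.detClass (isFiniteLocallyFree_serreTwist (ψ.left : X.left ⟶ PP ℂ a) 1)) :
    ch X L 1 =
      complexBetti.map ψ 2 (ch (projectiveSpace a ℂ)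
          (serreTwist (𝟙 (projectiveSpace a ℂ).left : (projectiveSpace a ℂ).left ⟶ PP ℂ a) 1) 1) -
        complexBetti.map φ 2 (ch (projectiveSpace a ℂ)
          (serreTwist (𝟙 (projectiveSpace a ℂ).left : (projectiveSpace a ℂ).left ⟶ PP ℂ a) 1) 1) := by
  set g : X ⟶ projectiveSpace a ℂ ⊗ projectiveSpace a ℂ := lift φ ψ with hg
  have h1 : ((g ≫ snd _ _).left : X.left ⟶ PP ℂ a) = ψ.left := by rw [hg, lift_snd]
  have h2 : ((g ≫ fst _ _).left : X.left ⟶ PP ℂ a) = φ.left := by rw [hg, lift_fst]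
  obtain ⟨e⟩ := (Modules.nonempty_iso_iff_detClass_eq hL
    (Modules.hasRank_pullback g.left (hasRank_twistDifference a)) (Modules.HasRank.isFiniteLocallyFree' hL)
    ((isFiniteLocallyFree_twistDifference a).pullback g.left)).2 (by
      rw [detClass_pullback_twistDifference, detClass_serreTwist_congr h1, detClass_serreTwist_congr h2, ← hcl,
        mul_inv_cancel_right])
  have hM := (isFiniteLocallyFree_twistDifference a).isVectorBundle
  have key : complexBetti.map g (2 * 1) (ch _ (twistDifference a) 1) =
      complexBetti.map ψ (2 * 1) (ch (projectiveSpace a ℂ)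
          (serreTwist (𝟙 (projectiveSpace a ℂ).left : (projectiveSpace a ℂ).left ⟶ PP ℂ a) 1) 1) -
        complexBetti.map φ (2 * 1) (ch (projectiveSpace a ℂ)
          (serreTwist (𝟙 (projectiveSpace a ℂ).left : (projectiveSpace a ℂ).left ⟶ PP ℂ a) 1) 1) := by
    rw [ch_twistDifference_one_eq ch h_congr h_map h_free a, map_sub, complexBetti_map_map_apply,
      complexBetti_map_map_apply, lift_fst, lift_snd]
  rw [h_congr e 1, ← h_map g _ hM 1]
  exact key

/-! ### §2 The scale of two lawful data on line bundles -/

/-- **Non-degeneracy produces a non-zero tautological class**: if `ch₁(L) ≠ 0` for some module `L` of rank `≤ 1` on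
some `ℙᴺ`, then `t_a(ch) ≠ 0` for some `a ≥ 1` (`L` is zero — impossible, `ch(0) = 0` — or a line bundle, and then
`ch₁(L) = ψ^* t_a − φ^* t_a` by the line bundle formula). [cite: Hartshorne1977, II Thm. 7.1 and II Ex. 5.8 (b)]
[cite: Grothendieck1958, Thm. 1 (uniqueness)] -/
theorem exists_ch_serreTwist_one_ne_zero_of_nonDegenerate
    (h_congr : ∀ {X : SchemeOver ℂ} {E F : X.left.Modules} (_ : E ≅ F) (i : ℕ), ch X E i = ch X F i)
    (h_shortExact : ∀ {X : SchemeOver ℂ} (S : ShortComplex X.left.Modules), S.ShortExact →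
      IsVectorBundle S.X₁ → IsVectorBundle S.X₃ → ∀ i : ℕ, ch X S.X₂ i = ch X S.X₁ i + ch X S.X₃ i)
    (h_map : ∀ {X Y : SchemeOver ℂ} (f : Y ⟶ X) (E : X.left.Modules), IsVectorBundle E →
      ∀ i : ℕ, complexBetti.map f (2 * i) (ch X E i) = ch Y ((Scheme.Modules.pullback f.left).obj E) i)
    (h_free : ∀ (X : SchemeOver ℂ) (I : Type) [Finite I] {i : ℕ}, 0 < i →
      ch X (SheafOfModules.free (R := X.left.ringCatSheaf) I) i = 0)
    (hnd : ∃ (N : ℕ) (L : (projectiveSpace N ℂ).left.Modules), HasRankLE L 1 ∧ ch (projectiveSpace N ℂ) L 1 ≠ 0) :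
    ∃ a : ℕ, 1 ≤ a ∧ ch (projectiveSpace a ℂ)
        (serreTwist (𝟙 (projectiveSpace a ℂ).left : (projectiveSpace a ℂ).left ⟶ PP ℂ a) 1) 1 ≠ 0 := by
  obtain ⟨N, L, hL1, hne⟩ := hnd
  have hP := isSmoothProjective_projectiveSpace_holds ℂ N
  haveI := hP.irreducibleSpace
  rcases RankLEOneDichotomy_holds (projectiveSpace N ℂ).left inferInstance L hL1 with h0 | h1
  · exact absurd (ch_eq_zero_of_isZero_of_shortExact ch h_shortExact h0 1) hne
  · obtain ⟨a, φ, ψ, ha, hcl⟩ := LineBundleClassEqDifferenceOfPullbacks_holds N _ hP L h1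
    refine ⟨a, ha, fun ht ↦ hne ?_⟩
    rw [ch_one_eq_of_detClass_eq ch h_congr h_map h_free h1 φ ψ hcl, ht, map_zero, map_zero, sub_self]

/-- **Ratios are compatible along `σ : ℙᴺ → ℙᴷ` with `[σ^*𝒪(-1)] = [𝒪(-1)]`**: if `t_N(ch') = q t_N(ch)`,
`t_K(ch') = r t_K(ch)` and `t_N(ch) ≠ 0`, then `q = r` (apply `σ^*` to the second identity).
[cite: Grothendieck1958, Thm. 1 (uniqueness)] [cite: Hartshorne1977, II Ex. 5.11 (p. 125)] -/
theorem scale_eq_of_detClass_eq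
    (h_congr : ∀ {X : SchemeOver ℂ} {E F : X.left.Modules} (_ : E ≅ F) (i : ℕ), ch X E i = ch X F i)
    (h_map : ∀ {X Y : SchemeOver ℂ} (f : Y ⟶ X) (E : X.left.Modules), IsVectorBundle E →
      ∀ i : ℕ, complexBetti.map f (2 * i) (ch X E i) = ch Y ((Scheme.Modules.pullback f.left).obj E) i)
    (h_congr' : ∀ {X : SchemeOver ℂ} {E F : X.left.Modules} (_ : E ≅ F) (i : ℕ), ch' X E i = ch' X F i)
    (h_map' : ∀ {X Y : SchemeOver ℂ} (f : Y ⟶ X) (E : X.left.Modules), IsVectorBundle E →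
      ∀ i : ℕ, complexBetti.map f (2 * i) (ch' X E i) = ch' Y ((Scheme.Modules.pullback f.left).obj E) i)
    {N K : ℕ} (σ : projectiveSpace N ℂ ⟶ projectiveSpace K ℂ)
    (hσ : Modules.detClass (isFiniteLocallyFree_serreTwist (σ.left : _ ⟶ PP ℂ K) 1) =
        Modules.detClass (isFiniteLocallyFree_serreTwist
          (𝟙 (projectiveSpace N ℂ).left : (projectiveSpace N ℂ).left ⟶ PP ℂ N) 1))
    {q r : ℂ}
    (hq : ch' (projectiveSpace N ℂ)
        (serreTwist (𝟙 (projectiveSpace N ℂ).left : (projectiveSpace N ℂ).left ⟶ PP ℂ N) 1) 1 =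
      q • ch (projectiveSpace N ℂ)
        (serreTwist (𝟙 (projectiveSpace N ℂ).left : (projectiveSpace N ℂ).left ⟶ PP ℂ N) 1) 1)
    (hr : ch' (projectiveSpace K ℂ)
        (serreTwist (𝟙 (projectiveSpace K ℂ).left : (projectiveSpace K ℂ).left ⟶ PP ℂ K) 1) 1 =
      r • ch (projectiveSpace K ℂ)
        (serreTwist (𝟙 (projectiveSpace K ℂ).left : (projectiveSpace K ℂ).left ⟶ PP ℂ K) 1) 1)
    (hN : ch (projectiveSpace N ℂ)
        (serreTwist (𝟙 (projectiveSpace N ℂ).left : (projectiveSpace N ℂ).left ⟶ PP ℂ N) 1) 1 ≠ 0) :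
    q = r := by
  have h := map_ch_serreTwist_one_eq_of_detClass_eq ch h_congr h_map σ hσ
  have h' := map_ch_serreTwist_one_eq_of_detClass_eq ch' h_congr' h_map' σ hσ
  rw [hr, map_smul, h, hq] at h'
  exact smul_left_injective ℂ hN h'.symm

/-- **(U2 for raw data) One scalar on all line bundles.** For a lawful non-degenerate `ch` and a lawful `ch'` there is
`q ∈ ℂ` with `ch'₁(L) = q • ch₁(L)` for every line bundle `L` on every smooth projective complex variety: `q` is the ratio
`t_K(ch')/t_K(ch)` on any `ℙᴷ`, `K = a₁M + a₁ + M` (`t_K(ch) ≠ 0`, `H²(ℙᴷ)` a line, ratios constant along `ℙ^{a₁} → ℙᴷ`),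
and every `L ≅ φ^*𝒪(1) ⊗ ψ^*𝒪(-1)` (Hartshorne II 7.1/7.6, `LineBundleClassEqDifferenceOfPullbacks_holds`) can be presented
with target `ℙᴷ`, `K = a₁a + a₁ + a`, where the line bundle formula applies to both data.
[cite: Grothendieck1958, Thm. 1 (uniqueness)] [cite: Hartshorne1977, II Thm. 7.1, II Thm. 7.6 and II Ex. 5.11] -/
theorem exists_scale_one_of_laws
    (h_congr : ∀ {X : SchemeOver ℂ} {E F : X.left.Modules} (_ : E ≅ F) (i : ℕ), ch X E i = ch X F i)
    (h_shortExact : ∀ {X : SchemeOver ℂ} (S : ShortComplex X.left.Modules), S.ShortExact →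
      IsVectorBundle S.X₁ → IsVectorBundle S.X₃ → ∀ i : ℕ, ch X S.X₂ i = ch X S.X₁ i + ch X S.X₃ i)
    (h_map : ∀ {X Y : SchemeOver ℂ} (f : Y ⟶ X) (E : X.left.Modules), IsVectorBundle E →
      ∀ i : ℕ, complexBetti.map f (2 * i) (ch X E i) = ch Y ((Scheme.Modules.pullback f.left).obj E) i)
    (h_free : ∀ (X : SchemeOver ℂ) (I : Type) [Finite I] {i : ℕ}, 0 < i →
      ch X (SheafOfModules.free (R := X.left.ringCatSheaf) I) i = 0)
    (hnd : ∃ (N : ℕ) (L : (projectiveSpace N ℂ).left.Modules), HasRankLE L 1 ∧ ch (projectiveSpace N ℂ) L 1 ≠ 0)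
    (h_congr' : ∀ {X : SchemeOver ℂ} {E F : X.left.Modules} (_ : E ≅ F) (i : ℕ), ch' X E i = ch' X F i)
    (h_map' : ∀ {X Y : SchemeOver ℂ} (f : Y ⟶ X) (E : X.left.Modules), IsVectorBundle E →
      ∀ i : ℕ, complexBetti.map f (2 * i) (ch' X E i) = ch' Y ((Scheme.Modules.pullback f.left).obj E) i)
    (h_free' : ∀ (X : SchemeOver ℂ) (I : Type) [Finite I] {i : ℕ}, 0 < i →
      ch' X (SheafOfModules.free (R := X.left.ringCatSheaf) I) i = 0) :
    ∃ q : ℂ, ∀ {n : ℕ} {X : SchemeOver ℂ}, IsSmoothProjective n X → ∀ {L : X.left.Modules}, HasRank L 1 →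
      ch' X L 1 = q • ch X L 1 := by
  obtain ⟨a₁, ha₁, hne⟩ :=
    exists_ch_serreTwist_one_ne_zero_of_nonDegenerate ch h_congr h_shortExact h_map h_free hnd
  -- the scalar: the ratio on `ℙ^{a₁}`
  obtain ⟨q, hq⟩ := exists_eq_smul_of_ne_zero_complexBetti_projectiveSpace_two ha₁ hne
    (ch' (projectiveSpace a₁ ℂ)
      (serreTwist (𝟙 (projectiveSpace a₁ ℂ).left : (projectiveSpace a₁ ℂ).left ⟶ PP ℂ a₁) 1) 1)
  refine ⟨q, fun {n} {X} hX {L} hL ↦ ?_⟩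
  obtain ⟨a, φ, ψ, -, hcl⟩ := LineBundleClassEqDifferenceOfPullbacks_holds n X hX L hL
  -- move to `ℙᴷ`, `K = a₁ a + a₁ + a`, which receives both `ℙ^{a₁}` (so `t_K(ch) ≠ 0`, ratio `q`) and `ℙᵃ`
  have hneK := ch_serreTwist_one_ne_zero_segre ch h_congr h_map hne a
  have hK1 : 1 ≤ a₁ * a + a₁ + a := le_trans ha₁ ((Nat.le_add_left a₁ (a₁ * a)).trans (Nat.le_add_right _ a))
  obtain ⟨r, hr⟩ := exists_eq_smul_of_ne_zero_complexBetti_projectiveSpace_two hK1 hneK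
    (ch' (projectiveSpace (a₁ * a + a₁ + a) ℂ)
      (serreTwist (𝟙 (projectiveSpace (a₁ * a + a₁ + a) ℂ).left :
        (projectiveSpace (a₁ * a + a₁ + a) ℂ).left ⟶ PP ℂ (a₁ * a + a₁ + a)) 1) 1)
  obtain ⟨σ₁, hσ₁⟩ := exists_segre_detClass_eq a₁ a
  have hqr : q = r := scale_eq_of_detClass_eq ch ch' h_congr h_map h_congr' h_map' σ₁ hσ₁ hq hr hne
  obtain ⟨σ₂, hσ₂⟩ := exists_segre_detClass_eq' a₁ a
  have hcl' : Modules.detClass (Modules.HasRank.isFiniteLocallyFree' hL) *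
      Modules.detClass (isFiniteLocallyFree_serreTwist ((φ ≫ σ₂).left : X.left ⟶ PP ℂ (a₁ * a + a₁ + a)) 1) =
        Modules.detClass (isFiniteLocallyFree_serreTwist ((ψ ≫ σ₂).left : X.left ⟶ PP ℂ (a₁ * a + a₁ + a)) 1) := by
    rw [detClass_serreTwist_comp_left_eq φ σ₂ hσ₂, detClass_serreTwist_comp_left_eq ψ σ₂ hσ₂]
    exact hcl
  rw [ch_one_eq_of_detClass_eq ch' h_congr' h_map' h_free' hL (φ ≫ σ₂) (ψ ≫ σ₂) hcl',
    ch_one_eq_of_detClass_eq ch h_congr h_map h_free hL (φ ≫ σ₂) (ψ ≫ σ₂) hcl', hr, ← hqr, map_smul, map_smul,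
    smul_sub]

/-! ### §3 All degrees, all vector bundles -/

/-- **(U3 for raw data)** `ch' L i = qⁱ • ch L i` (`0 < i`) for `L` of rank `≤ 1` on a smooth projective variety, once
`ch'₁ = q • ch₁` on line bundles: `L` is zero (both sides vanish) or a line bundle, where `chᵢ(L) = ch₁(L)ⁱ/i!` on both
sides. [cite: Fulton1998, §15.1 (iii) (PDF p. 272)] [cite: Hartshorne1977, II Ex. 5.8 (b)] -/
theorem ch_eq_pow_smul_of_hasRankLE_one_of_laws
    (h_shortExact : ∀ {X : SchemeOver ℂ} (S : ShortComplex X.left.Modules), S.ShortExact →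
      IsVectorBundle S.X₁ → IsVectorBundle S.X₃ → ∀ i : ℕ, ch X S.X₂ i = ch X S.X₁ i + ch X S.X₃ i)
    (h_exp : ∀ {X : SchemeOver ℂ} {L : X.left.Modules}, HasRankLE L 1 →
      ∀ {i : ℕ}, 0 < i → ch X L i = ((Nat.factorial i : ℕ) : ℂ)⁻¹ • cupPowTwo (ch X L 1) i)
    (h_shortExact' : ∀ {X : SchemeOver ℂ} (S : ShortComplex X.left.Modules), S.ShortExact →
      IsVectorBundle S.X₁ → IsVectorBundle S.X₃ → ∀ i : ℕ, ch' X S.X₂ i = ch' X S.X₁ i + ch' X S.X₃ i)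
    (h_exp' : ∀ {X : SchemeOver ℂ} {L : X.left.Modules}, HasRankLE L 1 →
      ∀ {i : ℕ}, 0 < i → ch' X L i = ((Nat.factorial i : ℕ) : ℂ)⁻¹ • cupPowTwo (ch' X L 1) i)
    {q : ℂ} (hq : ∀ {n : ℕ} {X : SchemeOver ℂ}, IsSmoothProjective n X → ∀ {L : X.left.Modules}, HasRank L 1 →
      ch' X L 1 = q • ch X L 1)
    {n : ℕ} {X : SchemeOver ℂ} (hX : IsSmoothProjective n X) {L : X.left.Modules} (hL : HasRankLE L 1)
    {i : ℕ} (hi : 0 < i) : ch' X L i = q ^ i • ch X L i := by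
  haveI := hX.irreducibleSpace
  rcases RankLEOneDichotomy_holds X.left inferInstance L hL with h0 | h1
  · rw [ch_eq_zero_of_isZero_of_shortExact ch h_shortExact h0 i,
      ch_eq_zero_of_isZero_of_shortExact ch' h_shortExact' h0 i, smul_zero]
  · rw [h_exp hL hi, h_exp' hL hi, hq hX h1, cupPowTwo_smul_aux, smul_comm]

/-- **`ch' E i = qⁱ • ch E i` (`0 < i`) for a module with a full flag** on a smooth projective variety: induction along the
flag with additivity on both sides. [cite: Fulton1984, §4.1 (splitting principle (i))] [cite: Fulton1998, Example 3.2.3] -/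
theorem ch_eq_pow_smul_of_hasFullFlag_of_laws
    (h_shortExact : ∀ {X : SchemeOver ℂ} (S : ShortComplex X.left.Modules), S.ShortExact →
      IsVectorBundle S.X₁ → IsVectorBundle S.X₃ → ∀ i : ℕ, ch X S.X₂ i = ch X S.X₁ i + ch X S.X₃ i)
    (h_exp : ∀ {X : SchemeOver ℂ} {L : X.left.Modules}, HasRankLE L 1 →
      ∀ {i : ℕ}, 0 < i → ch X L i = ((Nat.factorial i : ℕ) : ℂ)⁻¹ • cupPowTwo (ch X L 1) i)
    (h_shortExact' : ∀ {X : SchemeOver ℂ} (S : ShortComplex X.left.Modules), S.ShortExact →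
      IsVectorBundle S.X₁ → IsVectorBundle S.X₃ → ∀ i : ℕ, ch' X S.X₂ i = ch' X S.X₁ i + ch' X S.X₃ i)
    (h_exp' : ∀ {X : SchemeOver ℂ} {L : X.left.Modules}, HasRankLE L 1 →
      ∀ {i : ℕ}, 0 < i → ch' X L i = ((Nat.factorial i : ℕ) : ℂ)⁻¹ • cupPowTwo (ch' X L 1) i)
    {q : ℂ} (hq : ∀ {n : ℕ} {X : SchemeOver ℂ}, IsSmoothProjective n X → ∀ {L : X.left.Modules}, HasRank L 1 →
      ch' X L 1 = q • ch X L 1)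
    {n : ℕ} {X : SchemeOver ℂ} (hX : IsSmoothProjective n X) {E : X.left.Modules} (hE : HasFullFlag E)
    {i : ℕ} (hi : 0 < i) : ch' X E i = q ^ i • ch X E i := by
  induction hE with
  | of_isZero E hE =>
    rw [ch_eq_zero_of_isZero_of_shortExact ch h_shortExact hE i,
      ch_eq_zero_of_isZero_of_shortExact ch' h_shortExact' hE i, smul_zero]
  | of_shortExact S hS h₁ h₃ ih =>
    rw [h_shortExact S hS (HasFullFlag.isVectorBundle_holds h₁) h₃.isVectorBundle i,
      h_shortExact' S hS (HasFullFlag.isVectorBundle_holds h₁) h₃.isVectorBundle i, ih,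
      ch_eq_pow_smul_of_hasRankLE_one_of_laws ch ch' h_shortExact h_exp h_shortExact' h_exp' hq hX h₃ hi, smul_add]

/-- **LEMMA U for raw data (Grothendieck's uniqueness theorem).** For two data `ch`, `ch'` on all `ℂ`-schemes, each
invariant under isomorphism, additive on short exact sequences of vector bundles, functorial along `ℂ`-morphisms,
vanishing in positive degrees on free modules and exponential on rank `≤ 1`, with `ch` NON-DEGENERATE, there is ONE
`q ∈ ℂ` with `ch' X E i = qⁱ • ch X E i` for every vector bundle `E` on every smooth projective complex variety `X` and every
`i ≥ 1` (line bundles §2; rank `≤ 1` and flags §3; all bundles by the splitting principle — `splittingPrincipleBetti_holds`,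
`f^*` injective — and functoriality). [cite: Grothendieck1958, Thm. 1 (uniqueness) and §2]
[cite: Fulton1984, §4.1 (splitting principle)] [cite: Hartshorne1977, II Thm. 7.1 and II Thm. 7.6] -/
theorem exists_scale_of_laws
    (h_congr : ∀ {X : SchemeOver ℂ} {E F : X.left.Modules} (_ : E ≅ F) (i : ℕ), ch X E i = ch X F i)
    (h_shortExact : ∀ {X : SchemeOver ℂ} (S : ShortComplex X.left.Modules), S.ShortExact →
      IsVectorBundle S.X₁ → IsVectorBundle S.X₃ → ∀ i : ℕ, ch X S.X₂ i = ch X S.X₁ i + ch X S.X₃ i)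
    (h_map : ∀ {X Y : SchemeOver ℂ} (f : Y ⟶ X) (E : X.left.Modules), IsVectorBundle E →
      ∀ i : ℕ, complexBetti.map f (2 * i) (ch X E i) = ch Y ((Scheme.Modules.pullback f.left).obj E) i)
    (h_free : ∀ (X : SchemeOver ℂ) (I : Type) [Finite I] {i : ℕ}, 0 < i →
      ch X (SheafOfModules.free (R := X.left.ringCatSheaf) I) i = 0)
    (h_exp : ∀ {X : SchemeOver ℂ} {L : X.left.Modules}, HasRankLE L 1 →
      ∀ {i : ℕ}, 0 < i → ch X L i = ((Nat.factorial i : ℕ) : ℂ)⁻¹ • cupPowTwo (ch X L 1) i)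
    (hnd : ∃ (N : ℕ) (L : (projectiveSpace N ℂ).left.Modules), HasRankLE L 1 ∧ ch (projectiveSpace N ℂ) L 1 ≠ 0)
    (h_congr' : ∀ {X : SchemeOver ℂ} {E F : X.left.Modules} (_ : E ≅ F) (i : ℕ), ch' X E i = ch' X F i)
    (h_shortExact' : ∀ {X : SchemeOver ℂ} (S : ShortComplex X.left.Modules), S.ShortExact →
      IsVectorBundle S.X₁ → IsVectorBundle S.X₃ → ∀ i : ℕ, ch' X S.X₂ i = ch' X S.X₁ i + ch' X S.X₃ i)
    (h_map' : ∀ {X Y : SchemeOver ℂ} (f : Y ⟶ X) (E : X.left.Modules), IsVectorBundle E →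
      ∀ i : ℕ, complexBetti.map f (2 * i) (ch' X E i) = ch' Y ((Scheme.Modules.pullback f.left).obj E) i)
    (h_free' : ∀ (X : SchemeOver ℂ) (I : Type) [Finite I] {i : ℕ}, 0 < i →
      ch' X (SheafOfModules.free (R := X.left.ringCatSheaf) I) i = 0)
    (h_exp' : ∀ {X : SchemeOver ℂ} {L : X.left.Modules}, HasRankLE L 1 →
      ∀ {i : ℕ}, 0 < i → ch' X L i = ((Nat.factorial i : ℕ) : ℂ)⁻¹ • cupPowTwo (ch' X L 1) i) :
    ∃ q : ℂ, ∀ {n : ℕ} {X : SchemeOver ℂ}, IsSmoothProjective n X → ∀ (E : X.left.Modules), IsVectorBundle E →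
      ∀ {i : ℕ}, 0 < i → ch' X E i = q ^ i • ch X E i := by
  obtain ⟨q, hq⟩ := exists_scale_one_of_laws ch ch' h_congr h_shortExact h_map h_free hnd h_congr' h_map' h_free'
  refine ⟨q, fun {n} {X} hX E hE {i} hi ↦ ?_⟩
  obtain ⟨n', Y, f, hY, hf, hflag⟩ := splittingPrincipleBetti_holds n X hX E hE
  apply hf (2 * i)
  rw [h_map' f E hE i, map_smul, h_map f E hE i]
  exact ch_eq_pow_smul_of_hasFullFlag_of_laws ch ch' h_shortExact h_exp h_shortExact' h_exp' hq hY hflag hi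

/-- **The scale of two NON-DEGENERATE lawful data is non-zero** (and hence, by symmetry, each is a rescaling of the
other): if `ch'₁(L') ≠ 0` for some `L'` of rank `≤ 1` on some `ℙᴺ`, then `q ≠ 0` in `ch' = qⁱ • ch`.
[cite: Grothendieck1958, Thm. 1 (uniqueness)] -/
theorem exists_scale_ne_zero_of_laws
    (h_congr : ∀ {X : SchemeOver ℂ} {E F : X.left.Modules} (_ : E ≅ F) (i : ℕ), ch X E i = ch X F i)
    (h_shortExact : ∀ {X : SchemeOver ℂ} (S : ShortComplex X.left.Modules), S.ShortExact →
      IsVectorBundle S.X₁ → IsVectorBundle S.X₃ → ∀ i : ℕ, ch X S.X₂ i = ch X S.X₁ i + ch X S.X₃ i)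
    (h_map : ∀ {X Y : SchemeOver ℂ} (f : Y ⟶ X) (E : X.left.Modules), IsVectorBundle E →
      ∀ i : ℕ, complexBetti.map f (2 * i) (ch X E i) = ch Y ((Scheme.Modules.pullback f.left).obj E) i)
    (h_free : ∀ (X : SchemeOver ℂ) (I : Type) [Finite I] {i : ℕ}, 0 < i →
      ch X (SheafOfModules.free (R := X.left.ringCatSheaf) I) i = 0)
    (h_exp : ∀ {X : SchemeOver ℂ} {L : X.left.Modules}, HasRankLE L 1 →
      ∀ {i : ℕ}, 0 < i → ch X L i = ((Nat.factorial i : ℕ) : ℂ)⁻¹ • cupPowTwo (ch X L 1) i)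
    (hnd : ∃ (N : ℕ) (L : (projectiveSpace N ℂ).left.Modules), HasRankLE L 1 ∧ ch (projectiveSpace N ℂ) L 1 ≠ 0)
    (h_congr' : ∀ {X : SchemeOver ℂ} {E F : X.left.Modules} (_ : E ≅ F) (i : ℕ), ch' X E i = ch' X F i)
    (h_shortExact' : ∀ {X : SchemeOver ℂ} (S : ShortComplex X.left.Modules), S.ShortExact →
      IsVectorBundle S.X₁ → IsVectorBundle S.X₃ → ∀ i : ℕ, ch' X S.X₂ i = ch' X S.X₁ i + ch' X S.X₃ i)
    (h_map' : ∀ {X Y : SchemeOver ℂ} (f : Y ⟶ X) (E : X.left.Modules), IsVectorBundle E →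
      ∀ i : ℕ, complexBetti.map f (2 * i) (ch' X E i) = ch' Y ((Scheme.Modules.pullback f.left).obj E) i)
    (h_free' : ∀ (X : SchemeOver ℂ) (I : Type) [Finite I] {i : ℕ}, 0 < i →
      ch' X (SheafOfModules.free (R := X.left.ringCatSheaf) I) i = 0)
    (h_exp' : ∀ {X : SchemeOver ℂ} {L : X.left.Modules}, HasRankLE L 1 →
      ∀ {i : ℕ}, 0 < i → ch' X L i = ((Nat.factorial i : ℕ) : ℂ)⁻¹ • cupPowTwo (ch' X L 1) i)
    (hnd' : ∃ (N : ℕ) (L : (projectiveSpace N ℂ).left.Modules), HasRankLE L 1 ∧ ch' (projectiveSpace N ℂ) L 1 ≠ 0) :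
    ∃ q : ℂ, q ≠ 0 ∧ ∀ {n : ℕ} {X : SchemeOver ℂ}, IsSmoothProjective n X → ∀ (E : X.left.Modules), IsVectorBundle E →
      ∀ {i : ℕ}, 0 < i → ch' X E i = q ^ i • ch X E i := by
  obtain ⟨q, hq⟩ := exists_scale_of_laws ch ch' h_congr h_shortExact h_map h_free h_exp hnd h_congr' h_shortExact'
    h_map' h_free' h_exp'
  refine ⟨q, fun hq0 ↦ ?_, hq⟩
  obtain ⟨N, L, hL1, hne'⟩ := hnd'
  exact hne' (by rw [hq (isSmoothProjective_projectiveSpace_holds ℂ N) L hL1.isVectorBundle one_pos, hq0, pow_one,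
    zero_smul])

/-- **Spans agree**: two lawful NON-DEGENERATE data have the same `ℂ`-span `ℂ · {ch_p(E) : E vector bundle}` in every
positive degree on every smooth projective complex variety (`ch'_p(E) = qᵖ ch_p(E)`, `q ≠ 0`). Hence the span law
`Nᵖ H²ᵖ ⊆ ℂ · {ch_p(E)}` (Fulton Ex. 15.2.16 (b) / Deligne's Remark (ii)) holds for every lawful non-degenerate datum as
soon as it holds for one. [cite: Grothendieck1958, Thm. 1 (uniqueness)] [cite: Fulton1998, Example 15.2.16 (b)]
[cite: Deligne2000, §2 Remark (ii)] -/
theorem span_ch_eq_of_laws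
    (h_congr : ∀ {X : SchemeOver ℂ} {E F : X.left.Modules} (_ : E ≅ F) (i : ℕ), ch X E i = ch X F i)
    (h_shortExact : ∀ {X : SchemeOver ℂ} (S : ShortComplex X.left.Modules), S.ShortExact →
      IsVectorBundle S.X₁ → IsVectorBundle S.X₃ → ∀ i : ℕ, ch X S.X₂ i = ch X S.X₁ i + ch X S.X₃ i)
    (h_map : ∀ {X Y : SchemeOver ℂ} (f : Y ⟶ X) (E : X.left.Modules), IsVectorBundle E →
      ∀ i : ℕ, complexBetti.map f (2 * i) (ch X E i) = ch Y ((Scheme.Modules.pullback f.left).obj E) i)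
    (h_free : ∀ (X : SchemeOver ℂ) (I : Type) [Finite I] {i : ℕ}, 0 < i →
      ch X (SheafOfModules.free (R := X.left.ringCatSheaf) I) i = 0)
    (h_exp : ∀ {X : SchemeOver ℂ} {L : X.left.Modules}, HasRankLE L 1 →
      ∀ {i : ℕ}, 0 < i → ch X L i = ((Nat.factorial i : ℕ) : ℂ)⁻¹ • cupPowTwo (ch X L 1) i)
    (hnd : ∃ (N : ℕ) (L : (projectiveSpace N ℂ).left.Modules), HasRankLE L 1 ∧ ch (projectiveSpace N ℂ) L 1 ≠ 0)
    (h_congr' : ∀ {X : SchemeOver ℂ} {E F : X.left.Modules} (_ : E ≅ F) (i : ℕ), ch' X E i = ch' X F i)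
    (h_shortExact' : ∀ {X : SchemeOver ℂ} (S : ShortComplex X.left.Modules), S.ShortExact →
      IsVectorBundle S.X₁ → IsVectorBundle S.X₃ → ∀ i : ℕ, ch' X S.X₂ i = ch' X S.X₁ i + ch' X S.X₃ i)
    (h_map' : ∀ {X Y : SchemeOver ℂ} (f : Y ⟶ X) (E : X.left.Modules), IsVectorBundle E →
      ∀ i : ℕ, complexBetti.map f (2 * i) (ch' X E i) = ch' Y ((Scheme.Modules.pullback f.left).obj E) i)
    (h_free' : ∀ (X : SchemeOver ℂ) (I : Type) [Finite I] {i : ℕ}, 0 < i →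
      ch' X (SheafOfModules.free (R := X.left.ringCatSheaf) I) i = 0)
    (h_exp' : ∀ {X : SchemeOver ℂ} {L : X.left.Modules}, HasRankLE L 1 →
      ∀ {i : ℕ}, 0 < i → ch' X L i = ((Nat.factorial i : ℕ) : ℂ)⁻¹ • cupPowTwo (ch' X L 1) i)
    (hnd' : ∃ (N : ℕ) (L : (projectiveSpace N ℂ).left.Modules), HasRankLE L 1 ∧ ch' (projectiveSpace N ℂ) L 1 ≠ 0)
    {n : ℕ} {X : SchemeOver ℂ} (hX : IsSmoothProjective n X) {p : ℕ} (hp : 0 < p) :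
    Submodule.span ℂ {c | ∃ E : X.left.Modules, IsVectorBundle E ∧ ch' X E p = c} =
      Submodule.span ℂ {c | ∃ E : X.left.Modules, IsVectorBundle E ∧ ch X E p = c} := by
  obtain ⟨q, hq0, hq⟩ := exists_scale_ne_zero_of_laws ch ch' h_congr h_shortExact h_map h_free h_exp hnd h_congr'
    h_shortExact' h_map' h_free' h_exp' hnd'
  apply le_antisymm
  · refine Submodule.span_le.2 ?_
    rintro _ ⟨E, hE, rfl⟩
    rw [hq hX E hE hp]
    exact Submodule.smul_mem _ _ (Submodule.subset_span ⟨E, hE, rfl⟩)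
  · refine Submodule.span_le.2 ?_
    rintro _ ⟨E, hE, rfl⟩
    have h : ch X E p = (q ^ p)⁻¹ • ch' X E p := by
      rw [hq hX E hE hp, smul_smul, inv_mul_cancel₀ (pow_ne_zero p hq0), one_smul]
    rw [h]
    exact Submodule.smul_mem _ _ (Submodule.subset_span ⟨E, hE, rfl⟩)

end HodgeTheory

end Literature.AlgebraicGeometry.HodgeTheory

end
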